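import Summits.CriticalPhenomena.PercolationContinuityZ3.Theorems.PercMinContactMinContactExponentTwoGhostTailMoment
import HarnessLib

/-!
# The two-ghost inequality with an a-priori one-arm tail on `ℤ^d` (Hutchcroft 2021, Thm. 3.1 mechanism; part 2)

Crux `Summit.CriticalPhenomena.PercolationContinuityZ3.Theses.PercMinContact.MinContactExponent`
(item stmt-CriticalPhenomena-11498), line `registered` (`Cruxes/MinContactExponent/Lines/birth.lean`),
helper of the lead (prover-line-stmt-CriticalPhenomena-11498-c3-0), `--supports stmt-CriticalPhenomena-11498`.

Part 1 (`PercMinContactMinContactExponentTwoGhostTailMoment.lean`) kept the one-arm probabilities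
`a_k = P_p(|E(C(x))| ≥ k+1)` in the second moment of the exploration martingale:
`(E F)² ≤ p(1-p) Σ_k min(1/n², 1/(k+1)²) a_k` (`TwoGhostTail.lintegral_F4_sq_le_sum`). Here:

* `TwoGhostTail.armE_le_ofReal_of_volumeTail` — the tail hypothesis `P_p(|C(x)| ≥ m) ≤ A m^{-θ}` in edge
  units (`|E(C)| ≤ 2d|C|`);
* `TwoGhostTail.tsum_awt_armE_le_of_volumeTail` — `Σ_k min(1/n², 1/(k+1)²) a_k ≤ 4dA n^{-1-θ}/(1-θ)`;
* **`twoGhost_of_volumeTail`** (labelled-edge form) and **`twoGhost_of_volumeTail_adj`** (edge form, the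
  event of Hutchcroft 2020 Cor. 1.7) — for `d ≥ 1`, `0 < p`, `n ≥ 1`, an edge `e = {x, y}`: if
  `P_p(|C(x)| ≥ m) ≤ A m^{-θ}` for all `m ≥ 1` (`A ≥ 0`, `0 ≤ θ < 1`) then
  `P_p(e closed, x ↮ y, both clusters touch ≥ n edges, one finite) ≤ 32 d² √((1-p)/p) √(A/(1-θ)) · n^{-(1+θ)/2}`.
  At `θ = 0`, `A = 1` this is Hutchcroft 2020 Cor. 1.7 (the tree's `TwoGhost.measureReal_twoArm_le`) up to
  the constant; for `θ > 0` the exponent `1/2` improves to `(1+θ)/2` — "two-ghost ⊗ one-arm tail".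

What this means for the line: with the Markov tail `A = χ(p)^θ` (any `θ < 1`) the two-cluster side of the
square-root split is a THEOREM up to the costume threshold (`m(u) ≲ χ(u)^{1-θ/2}`, next file), so every
remaining difficulty of the line sits in its one-cluster residue.

References: T. Hutchcroft, arXiv:2008.11197, Thm. 3.1 [Hutchcroft2021]; arXiv:1808.08940, §3 [Hutchcroft2020Locality].
-/

noncomputable section

namespace Summit.CriticalPhenomena.PercolationContinuityZ3.Theorems

open MeasureTheory ProbabilityTheory Filter Literature.Probability.Percolation Literature.Probability.LatticeModels
open Literature.Probability.Percolation.TwoGhost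
open scoped ENNReal Topology

namespace TwoGhostTail

variable {d : ℕ}

/-! ## The a-priori tail: from `P(|C| ≥ m) ≤ A m^{-θ}` to the two-ghost bound with exponent `(1+θ)/2` -/

/-- `{|E(C(x))| ≥ k+1} ⊆ {|C(x)| ≥ ⌊k/2d⌋ + 1}`: a finite cluster touches at most `2d|C|` edges
(`TwoGhost.ncard_touch_le`). [folklore] -/
theorem armE_le_measure_clusterSizeGe (p : unitInterval) (x : Site d) (k : ℕ) :
    bondPercolation (zdGraph d) p {ω | ((k + 1 : ℕ) : ℕ∞) ≤ (touch (zdGraph d) (openCluster ω x)).encard} ≤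
      bondPercolation (zdGraph d) p (clusterSizeGe x (k / (2 * d) + 1)) := by
  refine measure_mono fun ω (hω : ((k + 1 : ℕ) : ℕ∞) ≤ _) => ?_
  rw [mem_clusterSizeGe]
  by_cases hf : (openCluster ω x).Finite
  · have ht : (touch (zdGraph d) (openCluster ω x)).ncard ≤ 2 * d * (openCluster ω x).ncard := ncard_touch_le hf
    have hk : k + 1 ≤ (touch (zdGraph d) (openCluster ω x)).ncard := by
      rw [← (touch_finite hf).cast_ncard_eq] at hω
      exact_mod_cast hω
    have hlt : k / (2 * d) < (openCluster ω x).ncard := by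
      by_contra hle
      push Not at hle
      have h2 : 2 * d * (openCluster ω x).ncard ≤ 2 * d * (k / (2 * d)) := Nat.mul_le_mul_left _ hle
      have h3 : 2 * d * (k / (2 * d)) ≤ k := by rw [Nat.mul_comm]; exact Nat.div_mul_le_self k (2 * d)
      have := hk.trans (ht.trans (h2.trans h3))
      omega
    rw [← hf.cast_ncard_eq]
    exact_mod_cast hlt
  · rw [Set.encard_eq_top_iff.2 hf]
    exact le_top

/-- **The tail hypothesis in edge units**: if `P_p(|C(x)| ≥ m) ≤ A m^{-θ}` for all `m ≥ 1`
(`A ≥ 0`, `0 ≤ θ ≤ 1`, `d ≥ 1`), then `P_p(|E(C(x))| ≥ k+1) ≤ ofReal (2dA (k+1)^{-θ})`. [folklore] -/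
theorem armE_le_ofReal_of_volumeTail (hd : 1 ≤ d) (p : unitInterval) (x : Site d) {A θ : ℝ} (hA : 0 ≤ A)
    (hθ0 : 0 ≤ θ) (hθ1 : θ ≤ 1)
    (htail : ∀ m : ℕ, 1 ≤ m → (bondPercolation (zdGraph d) p).real (clusterSizeGe x m) ≤ A * (m : ℝ) ^ (-θ))
    (k : ℕ) :
    bondPercolation (zdGraph d) p {ω | ((k + 1 : ℕ) : ℕ∞) ≤ (touch (zdGraph d) (openCluster ω x)).encard} ≤
      ENNReal.ofReal (2 * d * A * ((k + 1 : ℕ) : ℝ) ^ (-θ)) := by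
  set m : ℕ := k / (2 * d) + 1 with hm
  have hd1 : (1 : ℝ) ≤ d := by exact_mod_cast hd
  have hd0 : (0 : ℝ) < 2 * d := by linarith
  have hk0 : (0 : ℝ) < ((k + 1 : ℕ) : ℝ) := by positivity
  -- `(k+1)/(2d) ≤ m`
  have hkm : ((k + 1 : ℕ) : ℝ) / (2 * d) ≤ (m : ℝ) := by
    rw [div_le_iff₀ hd0]
    have h := Nat.lt_mul_div_succ k (show 0 < 2 * d by omega)
    have h' : k + 1 ≤ 2 * d * m := h
    calc ((k + 1 : ℕ) : ℝ) ≤ ((2 * d * m : ℕ) : ℝ) := by exact_mod_cast h'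
      _ = (m : ℝ) * (2 * d) := by push_cast; ring
  -- `m^{-θ} ≤ ((k+1)/(2d))^{-θ} = (k+1)^{-θ} (2d)^θ ≤ 2d (k+1)^{-θ}`
  have h1 : (m : ℝ) ^ (-θ) ≤ (((k + 1 : ℕ) : ℝ) / (2 * d)) ^ (-θ) :=
    Real.rpow_le_rpow_of_nonpos (by positivity) hkm (by linarith)
  have h2 : (((k + 1 : ℕ) : ℝ) / (2 * d)) ^ (-θ) = ((k + 1 : ℕ) : ℝ) ^ (-θ) * (2 * d) ^ θ := by
    rw [Real.div_rpow hk0.le hd0.le, Real.rpow_neg hd0.le, div_inv_eq_mul]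
  have h3 : (2 * (d : ℝ)) ^ θ ≤ 2 * d := by
    have h1d : (1 : ℝ) ≤ 2 * d := by linarith
    calc (2 * (d : ℝ)) ^ θ ≤ (2 * d) ^ (1 : ℝ) := Real.rpow_le_rpow_of_exponent_le h1d hθ1
      _ = 2 * d := Real.rpow_one _
  have hreal : A * (m : ℝ) ^ (-θ) ≤ 2 * d * A * ((k + 1 : ℕ) : ℝ) ^ (-θ) := by
    have hb : 0 ≤ ((k + 1 : ℕ) : ℝ) ^ (-θ) := Real.rpow_nonneg hk0.le _
    calc A * (m : ℝ) ^ (-θ) ≤ A * (((k + 1 : ℕ) : ℝ) ^ (-θ) * (2 * d) ^ θ) := by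
          rw [← h2]; exact mul_le_mul_of_nonneg_left h1 hA
      _ ≤ A * (((k + 1 : ℕ) : ℝ) ^ (-θ) * (2 * d)) := by gcongr
      _ = 2 * d * A * ((k + 1 : ℕ) : ℝ) ^ (-θ) := by ring
  calc bondPercolation (zdGraph d) p {ω | ((k + 1 : ℕ) : ℕ∞) ≤ (touch (zdGraph d) (openCluster ω x)).encard}
      ≤ bondPercolation (zdGraph d) p (clusterSizeGe x m) := armE_le_measure_clusterSizeGe p x k
    _ = ENNReal.ofReal ((bondPercolation (zdGraph d) p).real (clusterSizeGe x m)) := (ofReal_measureReal).symm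
    _ ≤ ENNReal.ofReal (2 * d * A * ((k + 1 : ℕ) : ℝ) ^ (-θ)) :=
        ENNReal.ofReal_le_ofReal ((htail m (Nat.le_add_left 1 _)).trans hreal)

/-- **The weighted one-arm sum under the tail hypothesis**:
`Σ_k min(1/n², 1/(k+1)²) P_p(|E(C(x))| ≥ k+1) ≤ ofReal (4dA n^{-1-θ}/(1-θ))` (`0 ≤ θ < 1`, `n, d ≥ 1`).
[folklore] -/
theorem tsum_awt_armE_le_of_volumeTail (hd : 1 ≤ d) {n : ℕ} (hn : 1 ≤ n) (p : unitInterval) (x : Site d)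
    {A θ : ℝ} (hA : 0 ≤ A) (hθ0 : 0 ≤ θ) (hθ1 : θ < 1)
    (htail : ∀ m : ℕ, 1 ≤ m → (bondPercolation (zdGraph d) p).real (clusterSizeGe x m) ≤ A * (m : ℝ) ^ (-θ)) :
    ∑' k, awt n (k + 1) *
          bondPercolation (zdGraph d) p {ω | ((k + 1 : ℕ) : ℕ∞) ≤ (touch (zdGraph d) (openCluster ω x)).encard} ≤
      ENNReal.ofReal (4 * d * A * (n : ℝ) ^ (-1 - θ) / (1 - θ)) := by
  have h1θ : 0 < 1 - θ := by linarith
  have hn0 : (0 : ℝ) < n := by exact_mod_cast hn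
  have hdA : 0 ≤ 2 * (d : ℝ) * A := by positivity
  have hg := armE_le_ofReal_of_volumeTail hd p x hA hθ0 hθ1.le htail
  set g : ℕ → ℝ := fun k => 2 * d * A * ((k + 1 : ℕ) : ℝ) ^ (-θ) with hgdef
  have hg0 : ∀ k, 0 ≤ g k := fun k => mul_nonneg hdA (Real.rpow_nonneg (Nat.cast_nonneg _) _)
  -- `ℝ≥0∞`/`ℝ` conversions for `1/n`
  have hninv : (n : ℝ≥0∞)⁻¹ = ENNReal.ofReal ((n : ℝ)⁻¹) := by
    rw [ENNReal.ofReal_inv_of_pos hn0, ENNReal.ofReal_natCast]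
  -- head: `k < n`
  have hhead : ∑ k ∈ Finset.range n, awt n (k + 1) *
          bondPercolation (zdGraph d) p {ω | ((k + 1 : ℕ) : ℕ∞) ≤ (touch (zdGraph d) (openCluster ω x)).encard} ≤
      ENNReal.ofReal (2 * d * A * (n : ℝ) ^ (-1 - θ) / (1 - θ)) := by
    calc ∑ k ∈ Finset.range n, awt n (k + 1) *
          bondPercolation (zdGraph d) p {ω | ((k + 1 : ℕ) : ℕ∞) ≤ (touch (zdGraph d) (openCluster ω x)).encard}
        ≤ ∑ k ∈ Finset.range n, (n : ℝ≥0∞)⁻¹ ^ 2 * ENNReal.ofReal (g k) :=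
          Finset.sum_le_sum fun k _ => mul_le_mul' (min_le_left _ _) (hg k)
      _ = (n : ℝ≥0∞)⁻¹ ^ 2 * ENNReal.ofReal (∑ k ∈ Finset.range n, g k) := by
          rw [← Finset.mul_sum, ENNReal.ofReal_sum_of_nonneg fun k _ => hg0 k]
      _ ≤ (n : ℝ≥0∞)⁻¹ ^ 2 * ENNReal.ofReal (2 * d * A * ((n : ℝ) ^ (1 - θ) / (1 - θ))) := by
          gcongr
          rw [hgdef]
          simp_rw [← Finset.mul_sum]
          exact mul_le_mul_of_nonneg_left (sum_range_rpow_neg_le hθ0 hθ1 hn) hdA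
      _ = ENNReal.ofReal (2 * d * A * (n : ℝ) ^ (-1 - θ) / (1 - θ)) := by
          rw [hninv, ← ENNReal.ofReal_pow (inv_nonneg.2 hn0.le), ← ENNReal.ofReal_mul (by positivity)]
          congr 1
          have e1 : ((n : ℝ)⁻¹) ^ 2 * (n : ℝ) ^ (1 - θ) = (n : ℝ) ^ (-1 - θ) := by
            rw [← Real.rpow_neg_one, ← Real.rpow_natCast, ← Real.rpow_mul hn0.le, ← Real.rpow_add hn0]
            norm_num
            ring_nf
          calc ((n : ℝ)⁻¹) ^ 2 * (2 * d * A * ((n : ℝ) ^ (1 - θ) / (1 - θ)))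
              = 2 * d * A * (((n : ℝ)⁻¹) ^ 2 * (n : ℝ) ^ (1 - θ)) / (1 - θ) := by ring
            _ = 2 * d * A * (n : ℝ) ^ (-1 - θ) / (1 - θ) := by rw [e1]
  -- tail: `k = j + n`
  have htl : ∑' j, awt n (j + n + 1) *
          bondPercolation (zdGraph d) p {ω | ((j + n + 1 : ℕ) : ℕ∞) ≤ (touch (zdGraph d) (openCluster ω x)).encard} ≤
      ENNReal.ofReal (2 * d * A * (n : ℝ) ^ (-1 - θ)) := by
    have hterm : ∀ j, awt n (j + n + 1) *
          bondPercolation (zdGraph d) p {ω | ((j + n + 1 : ℕ) : ℕ∞) ≤ (touch (zdGraph d) (openCluster ω x)).encard} ≤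
        ((j + n + 1 : ℕ) : ℝ≥0∞)⁻¹ ^ 2 * ENNReal.ofReal (2 * d * A * (n : ℝ) ^ (-θ)) := by
      intro j
      refine mul_le_mul' (min_le_right _ _) ((hg (j + n)).trans (ENNReal.ofReal_le_ofReal ?_))
      refine mul_le_mul_of_nonneg_left ?_ hdA
      exact Real.rpow_le_rpow_of_nonpos hn0 (by push_cast; linarith) (by linarith)
    calc ∑' j, awt n (j + n + 1) *
          bondPercolation (zdGraph d) p {ω | ((j + n + 1 : ℕ) : ℕ∞) ≤ (touch (zdGraph d) (openCluster ω x)).encard}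
        ≤ ∑' j, ((j + n + 1 : ℕ) : ℝ≥0∞)⁻¹ ^ 2 * ENNReal.ofReal (2 * d * A * (n : ℝ) ^ (-θ)) :=
          ENNReal.tsum_le_tsum hterm
      _ = (∑' j, ((j + n + 1 : ℕ) : ℝ≥0∞)⁻¹ ^ 2) * ENNReal.ofReal (2 * d * A * (n : ℝ) ^ (-θ)) :=
          ENNReal.tsum_mul_right
      _ ≤ (n : ℝ≥0∞)⁻¹ * ENNReal.ofReal (2 * d * A * (n : ℝ) ^ (-θ)) :=
          mul_le_mul' (tsum_inv_sq_add_le hn) le_rfl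
      _ = ENNReal.ofReal (2 * d * A * (n : ℝ) ^ (-1 - θ)) := by
          rw [hninv, ← ENNReal.ofReal_mul (inv_nonneg.2 hn0.le)]
          congr 1
          have e2 : (n : ℝ)⁻¹ * (n : ℝ) ^ (-θ) = (n : ℝ) ^ (-1 - θ) := by
            rw [← Real.rpow_neg_one, ← Real.rpow_add hn0]
            ring_nf
          calc (n : ℝ)⁻¹ * (2 * d * A * (n : ℝ) ^ (-θ)) = 2 * d * A * ((n : ℝ)⁻¹ * (n : ℝ) ^ (-θ)) := by ring
            _ = 2 * d * A * (n : ℝ) ^ (-1 - θ) := by rw [e2]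
  -- assemble
  have hpos : 0 ≤ 2 * d * A * (n : ℝ) ^ (-1 - θ) := mul_nonneg hdA (Real.rpow_nonneg hn0.le _)
  calc ∑' k, awt n (k + 1) *
          bondPercolation (zdGraph d) p {ω | ((k + 1 : ℕ) : ℕ∞) ≤ (touch (zdGraph d) (openCluster ω x)).encard}
      = ∑ k ∈ Finset.range n, awt n (k + 1) *
          bondPercolation (zdGraph d) p {ω | ((k + 1 : ℕ) : ℕ∞) ≤ (touch (zdGraph d) (openCluster ω x)).encard} +
        ∑' j, awt n (j + n + 1) *
          bondPercolation (zdGraph d) p {ω | ((j + n + 1 : ℕ) : ℕ∞) ≤ (touch (zdGraph d) (openCluster ω x)).encard} :=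
        tsum_eq_sum_range_add_tsum (fun k => awt n (k + 1) *
          bondPercolation (zdGraph d) p {ω | ((k + 1 : ℕ) : ℕ∞) ≤ (touch (zdGraph d) (openCluster ω x)).encard}) n
    _ ≤ ENNReal.ofReal (2 * d * A * (n : ℝ) ^ (-1 - θ) / (1 - θ)) +
          ENNReal.ofReal (2 * d * A * (n : ℝ) ^ (-1 - θ)) := add_le_add hhead htl
    _ = ENNReal.ofReal (2 * d * A * (n : ℝ) ^ (-1 - θ) / (1 - θ) + 2 * d * A * (n : ℝ) ^ (-1 - θ)) :=
        (ENNReal.ofReal_add (div_nonneg hpos h1θ.le) hpos).symm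
    _ ≤ ENNReal.ofReal (4 * d * A * (n : ℝ) ^ (-1 - θ) / (1 - θ)) := by
        refine ENNReal.ofReal_le_ofReal ?_
        have hle : 2 * d * A * (n : ℝ) ^ (-1 - θ) ≤ 2 * d * A * (n : ℝ) ^ (-1 - θ) / (1 - θ) := by
          rw [le_div_iff₀ h1θ]
          nlinarith
        calc 2 * d * A * (n : ℝ) ^ (-1 - θ) / (1 - θ) + 2 * d * A * (n : ℝ) ^ (-1 - θ)
            ≤ 2 * d * A * (n : ℝ) ^ (-1 - θ) / (1 - θ) + 2 * d * A * (n : ℝ) ^ (-1 - θ) / (1 - θ) := by linarith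
          _ = 4 * d * A * (n : ℝ) ^ (-1 - θ) / (1 - θ) := by ring

/-- **`E F ≤ √(p(1-p)·4dA/(1-θ)) · n^{-(1+θ)/2}`** under the tail hypothesis (square root of
`lintegral_F4_sq_le_sum` ⊗ `tsum_awt_armE_le_of_volumeTail`).
[cite: Hutchcroft2021, Thm. 3.1 (two-ghost inequality with an a-priori volume-tail estimate; mechanism)] -/
theorem lintegral_F4_le_of_volumeTail (hd : 1 ≤ d) {n : ℕ} (hn : 1 ≤ n) (p : unitInterval) (x : Site d)
    {A θ : ℝ} (hA : 0 ≤ A) (hθ0 : 0 ≤ θ) (hθ1 : θ < 1)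
    (htail : ∀ m : ℕ, 1 ≤ m → (bondPercolation (zdGraph d) p).real (clusterSizeGe x m) ≤ A * (m : ℝ) ^ (-θ)) :
    ∫⁻ ω, F4 n p ω x ∂(bondPercolation (zdGraph d) p) ≤
      ENNReal.ofReal (Real.sqrt (p * (1 - p) * (4 * d * A / (1 - θ))) * (n : ℝ) ^ (-((1 + θ) / 2))) := by
  set P := bondPercolation (zdGraph d) p with hP
  have h1θ : 0 < 1 - θ := by linarith
  have hn0 : (0 : ℝ) < n := by exact_mod_cast hn
  have hpp : 0 ≤ (p : ℝ) * (1 - p) := mul_nonneg p.2.1 (sub_nonneg.2 p.2.2)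
  have hM : 0 ≤ (p : ℝ) * (1 - p) * (4 * d * A / (1 - θ)) := by positivity
  set s2 : ℝ := Real.sqrt (p * (1 - p) * (4 * d * A / (1 - θ))) * (n : ℝ) ^ (-((1 + θ) / 2)) with hs2
  have hs20 : 0 ≤ s2 := mul_nonneg (Real.sqrt_nonneg _) (Real.rpow_nonneg hn0.le _)
  have h2 : (∫⁻ ω, F4 n p ω x ∂P) ^ 2 ≤ ENNReal.ofReal (s2 ^ 2) := by
    calc (∫⁻ ω, F4 n p ω x ∂P) ^ 2 ≤ ENNReal.ofReal (p * (1 - p)) * ∑' k, awt n (k + 1) *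
          bondPercolation (zdGraph d) p {ω | ((k + 1 : ℕ) : ℕ∞) ≤ (touch (zdGraph d) (openCluster ω x)).encard} :=
          lintegral_F4_sq_le_sum n p x
      _ ≤ ENNReal.ofReal (p * (1 - p)) * ENNReal.ofReal (4 * d * A * (n : ℝ) ^ (-1 - θ) / (1 - θ)) := by
          gcongr
          exact tsum_awt_armE_le_of_volumeTail hd hn p x hA hθ0 hθ1 htail
      _ = ENNReal.ofReal (s2 ^ 2) := by
          rw [← ENNReal.ofReal_mul hpp]
          congr 1
          have hsq : ((n : ℝ) ^ (-((1 + θ) / 2))) ^ 2 = (n : ℝ) ^ (-1 - θ) := by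
            rw [← Real.rpow_natCast, ← Real.rpow_mul hn0.le]
            congr 1
            push_cast
            ring
          rw [hs2, mul_pow, Real.sq_sqrt hM, hsq]
          field_simp
  rw [ENNReal.ofReal_pow hs20] at h2
  exact (ENNReal.pow_le_pow_left_iff two_ne_zero).1 h2

end TwoGhostTail

variable {d : ℕ} in
open TwoGhostTail in
/-- **The two-ghost inequality with an a-priori volume tail, at a labelled edge of `ℤ^d`**
(Hutchcroft 2021, Thm. 3.1, nearest-neighbour version; at `θ = 0`, `A = 1` it is the tree's
`TwoGhost.measureReal_twoArm_le`, Hutchcroft 2020 Cor. 1.7, up to the constant). Let `d ≥ 1`, `0 < p`,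
`n ≥ 1`, `x` a site and `e` one of the `2d` edges at `x`. If the one-arm volume tail at `x` obeys
`P_p(|C(x)| ≥ m) ≤ A m^{-θ}` for all `m ≥ 1` (`A ≥ 0`, `0 ≤ θ < 1`), then the probability that `e` is closed,
its endpoints are not connected, both their clusters touch at least `n` edges and one of them is finite is
at most `32 d² √((1-p)/p) √(A/(1-θ)) · n^{-(1+θ)/2}`. Proof: Hutchcroft's Lemma 3.1 and mass transport
(`TwoGhost.sum_lintegral_Tgt_le`, unchanged), the exploration martingale with its EXACT second moment
`E[Z_N²] = p(1-p)E[T ∧ N]` kept (`TwoGhostTail.lintegral_sq_hp_le_sum`), Cauchy–Schwarz and summation by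
parts (`TwoGhostTail.lintegral_F4_sq_le_sum`), and the tail hypothesis summed against `min(1/n², 1/k²)`.
[cite: Hutchcroft2021, Thm. 3.1 (two-ghost with a-priori tail `P(|K| ≥ n) ≤ A n^{-θ}`)]
[cite: Hutchcroft2020Locality, Corollary 1.7 and §3 (Lemma 3.1, Thm. 1.6)] -/
theorem twoGhost_of_volumeTail (hd : 1 ≤ d) {n : ℕ} (hn : 1 ≤ n) (p : unitInterval)
    (hp0 : 0 < (p : ℝ)) (x : Site d) (ℓ : Site d × Fin d)
    (hℓ : ∃ i : Fin d, ℓ = (x, i) ∨ ℓ = (x - Pi.single i 1, i))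
    {A θ : ℝ} (hA : 0 ≤ A) (hθ0 : 0 ≤ θ) (hθ1 : θ < 1)
    (htail : ∀ m : ℕ, 1 ≤ m → (bondPercolation (zdGraph d) p).real (clusterSizeGe x m) ≤ A * (m : ℝ) ^ (-θ)) :
    (bondPercolation (zdGraph d) p).real (twoArm n ℓ) ≤
      32 * (d : ℝ) ^ 2 * Real.sqrt ((1 - p) / p) * Real.sqrt (A / (1 - θ)) * (n : ℝ) ^ (-((1 + θ) / 2)) := by
  set P := bondPercolation (zdGraph d) p with hP
  have h1θ : 0 < 1 - θ := by linarith
  have hn0 : (0 : ℝ) < n := by exact_mod_cast hn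
  have hp1 : (p : ℝ) ≤ 1 := p.2.2
  have hd1 : (1 : ℝ) ≤ d := by exact_mod_cast hd
  set s2 : ℝ := Real.sqrt (p * (1 - p) * (4 * d * A / (1 - θ))) * (n : ℝ) ^ (-((1 + θ) / 2)) with hs2
  set r : ℝ := Real.sqrt ((1 - p) / p) with hr
  set q : ℝ := Real.sqrt (A / (1 - θ)) with hq
  set e : ℝ := (n : ℝ) ^ (-((1 + θ) / 2)) with he
  have he0 : 0 ≤ e := Real.rpow_nonneg hn0.le _
  have hs20 : 0 ≤ s2 := mul_nonneg (Real.sqrt_nonneg _) he0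
  -- the chain of Steps 1–5 in `ℝ≥0∞`
  have hF4 : ∫⁻ ω, F4 n p ω x ∂P ≤ ENNReal.ofReal s2 :=
    lintegral_F4_le_of_volumeTail hd hn p x hA hθ0 hθ1 htail
  have hTsum : ∫⁻ ω, Tgt n ℓ ω ∂P ≤ ∑ i : Fin d, (∫⁻ ω, Tgt n (x, i) ω ∂P + ∫⁻ ω, Tgt n (x - Pi.single i 1, i) ω ∂P) := by
    obtain ⟨i, hi | hi⟩ := hℓ
    · calc ∫⁻ ω, Tgt n ℓ ω ∂P ≤ ∫⁻ ω, Tgt n (x, i) ω ∂P + ∫⁻ ω, Tgt n (x - Pi.single i 1, i) ω ∂P := by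
            rw [hi]; exact le_self_add
        _ ≤ _ := Finset.single_le_sum (f := fun i => ∫⁻ ω, Tgt n (x, i) ω ∂P + ∫⁻ ω, Tgt n (x - Pi.single i 1, i) ω ∂P)
            (fun _ _ => bot_le) (Finset.mem_univ i)
    · calc ∫⁻ ω, Tgt n ℓ ω ∂P ≤ ∫⁻ ω, Tgt n (x, i) ω ∂P + ∫⁻ ω, Tgt n (x - Pi.single i 1, i) ω ∂P := by
            rw [hi]; exact le_add_self
        _ ≤ _ := Finset.single_le_sum (f := fun i => ∫⁻ ω, Tgt n (x, i) ω ∂P + ∫⁻ ω, Tgt n (x - Pi.single i 1, i) ω ∂P)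
            (fun _ _ => bot_le) (Finset.mem_univ i)
  have hchain : ENNReal.ofReal (wt n n) ^ 2 * P (twoArm n ℓ) ≤
      2 * ENNReal.ofReal (1 / p) * (2 * d * ENNReal.ofReal s2) := by
    calc ENNReal.ofReal (wt n n) ^ 2 * P (twoArm n ℓ) ≤ ∫⁻ ω, Tgt n ℓ ω ∂P := sq_mul_measure_twoArm_le hd n p ℓ
      _ ≤ _ := hTsum
      _ ≤ 2 * ENNReal.ofReal (1 / p) * ∫⁻ ω, Mabs n p ω x ∂P := sum_lintegral_Tgt_le n p hp0 x
      _ ≤ 2 * ENNReal.ofReal (1 / p) * ∫⁻ ω, 2 * d * F4 n p ω x ∂P := by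
          gcongr with ω
          exact Mabs_le hd hn p ω x
      _ = 2 * ENNReal.ofReal (1 / p) * (2 * d * ∫⁻ ω, F4 n p ω x ∂P) := by
          rw [lintegral_const_mul _ (measurable_F4 n p x)]
      _ ≤ 2 * ENNReal.ofReal (1 / p) * (2 * d * ENNReal.ofReal s2) := by gcongr
  -- pass to real numbers
  have hfin : 2 * ENNReal.ofReal (1 / p) * (2 * d * ENNReal.ofReal s2) ≠ ∞ := by
    refine ENNReal.mul_ne_top (ENNReal.mul_ne_top ENNReal.ofNat_ne_top ENNReal.ofReal_ne_top)
      (ENNReal.mul_ne_top (ENNReal.mul_ne_top ENNReal.ofNat_ne_top (ENNReal.natCast_ne_top d)) ENNReal.ofReal_ne_top)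
  have hreal := ENNReal.toReal_mono hfin hchain
  have hw0 : 0 ≤ wt n n := wt_nonneg n n
  rw [ENNReal.toReal_mul, ENNReal.toReal_pow, ENNReal.toReal_ofReal hw0] at hreal
  simp only [ENNReal.toReal_mul, ENNReal.toReal_ofNat, ENNReal.toReal_natCast,
    ENNReal.toReal_ofReal (show (0 : ℝ) ≤ 1 / p by positivity), ENNReal.toReal_ofReal hs20] at hreal
  change wt n n ^ 2 * P.real (twoArm n ℓ) ≤ 2 * (1 / p) * (2 * d * s2) at hreal
  -- `s2 ≤ 2 d p r q e`
  have hsr : s2 ≤ 2 * (d : ℝ) * (p : ℝ) * r * q * e := by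
    rw [hs2]
    refine mul_le_mul_of_nonneg_right ?_ he0
    rw [Real.sqrt_le_left (by positivity)]
    have hr2 : r ^ 2 = (1 - p) / p := Real.sq_sqrt (div_nonneg (sub_nonneg.2 hp1) hp0.le)
    have hq2 : q ^ 2 = A / (1 - θ) := Real.sq_sqrt (div_nonneg hA h1θ.le)
    have hexp : (2 * (d : ℝ) * (p : ℝ) * r * q) ^ 2 = 4 * (d : ℝ) ^ 2 * ((p : ℝ) * (1 - p)) * (A / (1 - θ)) := by
      have e1 : (2 * (d : ℝ) * (p : ℝ) * r * q) ^ 2 = 4 * (d : ℝ) ^ 2 * ((p : ℝ) ^ 2 * r ^ 2) * q ^ 2 := by ring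
      have e2 : (p : ℝ) ^ 2 * r ^ 2 = p * (1 - p) := by
        rw [hr2]
        field_simp
      rw [e1, e2, hq2]
    rw [hexp]
    have hdd : (d : ℝ) ≤ (d : ℝ) ^ 2 := by nlinarith
    have hAθ : 0 ≤ A / (1 - θ) := div_nonneg hA h1θ.le
    have hpp : 0 ≤ (p : ℝ) * (1 - p) := mul_nonneg hp0.le (sub_nonneg.2 hp1)
    calc (p : ℝ) * (1 - p) * (4 * d * A / (1 - θ)) = 4 * d * (p * (1 - p)) * (A / (1 - θ)) := by ring
      _ ≤ 4 * d ^ 2 * (p * (1 - p)) * (A / (1 - θ)) := by gcongr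
  -- `w(n) ≥ 1/2`
  have hw : (1 / 2 : ℝ) ≤ wt n n := half_le_wt_self hn
  have hPnn : 0 ≤ P.real (twoArm n ℓ) := measureReal_nonneg
  have hw2 : (1 / 4 : ℝ) ≤ wt n n ^ 2 := by nlinarith
  have h1 : P.real (twoArm n ℓ) ≤ 4 * (2 * (1 / p) * (2 * d * s2)) := by
    have := mul_le_mul_of_nonneg_right hw2 hPnn
    linarith
  have hd0 : (0 : ℝ) ≤ d := Nat.cast_nonneg d
  calc P.real (twoArm n ℓ) ≤ 4 * (2 * (1 / p) * (2 * d * s2)) := h1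
    _ = 16 * d * s2 / p := by ring
    _ ≤ 16 * d * (2 * (d : ℝ) * (p : ℝ) * r * q * e) / p := by gcongr
    _ = 32 * (d : ℝ) ^ 2 * r * q * e := by
        field_simp
        ring

variable {d : ℕ} in
open TwoGhostTail in
/-- **The two-ghost inequality with an a-priori volume tail, edge form** (the event of Hutchcroft 2020
Cor. 1.7 / the tree's `Hutchcroft2020_twoGhost_corollary`, at an edge `{x, y}` of `ℤ^d`): for `d ≥ 1`,
`0 < p`, `n ≥ 1`, if `P_p(|C(x)| ≥ m) ≤ A m^{-θ}` for all `m ≥ 1` (`A ≥ 0`, `0 ≤ θ < 1`), then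
`P_p({x,y} closed, x ↮ y, |E(C(x))| ≥ n, |E(C(y))| ≥ n, C(x) or C(y) finite)
 ≤ 32 d² √((1-p)/p) √(A/(1-θ)) n^{-(1+θ)/2}`.
[cite: Hutchcroft2021, Thm. 3.1 (two-ghost with a-priori tail)] [cite: Hutchcroft2020Locality, Corollary 1.7] -/
theorem twoGhost_of_volumeTail_adj (hd : 1 ≤ d) (p : unitInterval) (hp0 : 0 < (p : ℝ)) {n : ℕ} (hn : 1 ≤ n)
    (x y : Site d) (hxy : (zdGraph d).Adj x y) {A θ : ℝ} (hA : 0 ≤ A) (hθ0 : 0 ≤ θ) (hθ1 : θ < 1)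
    (htail : ∀ m : ℕ, 1 ≤ m → (bondPercolation (zdGraph d) p).real (clusterSizeGe x m) ≤ A * (m : ℝ) ^ (-θ)) :
    (bondPercolation (zdGraph d) p).real
        {ω | s(x, y) ∉ ω ∧ ¬ (openGraph ω).Reachable x y ∧
            (n : ℕ∞) ≤ {e ∈ (zdGraph d).edgeSet | ∃ v ∈ e, v ∈ openCluster ω x}.encard ∧
            (n : ℕ∞) ≤ {e ∈ (zdGraph d).edgeSet | ∃ v ∈ e, v ∈ openCluster ω y}.encard ∧
            ((openCluster ω x).Finite ∨ (openCluster ω y).Finite)}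
      ≤ 32 * (d : ℝ) ^ 2 * Real.sqrt ((1 - p) / p) * Real.sqrt (A / (1 - θ)) * (n : ℝ) ^ (-((1 + θ) / 2)) := by
  obtain ⟨i, hi | hi⟩ := (zdGraph_adj_iff x y).1 hxy
  · -- `y = x + eᵢ`: the edge has label `(x, i)`
    have hS : {ω : BondConfig (Site d) | s(x, y) ∉ ω ∧ ¬ (openGraph ω).Reachable x y ∧
        (n : ℕ∞) ≤ {e ∈ (zdGraph d).edgeSet | ∃ v ∈ e, v ∈ openCluster ω x}.encard ∧
        (n : ℕ∞) ≤ {e ∈ (zdGraph d).edgeSet | ∃ v ∈ e, v ∈ openCluster ω y}.encard ∧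
        ((openCluster ω x).Finite ∨ (openCluster ω y).Finite)} = twoArm n (x, i) := by
      ext ω
      simp only [twoArm, Set.mem_setOf_eq, edgeOf, headOf, ← hi, touch, openCluster]
    rw [hS]
    exact twoGhost_of_volumeTail hd hn p hp0 x (x, i) ⟨i, Or.inl rfl⟩ hA hθ0 hθ1 htail
  · -- `x = y + eᵢ`: the edge has label `(y, i) = (x - eᵢ, i)`
    have hyx : y = x - Pi.single i 1 := by rw [hi, add_sub_cancel_right]
    have hS : {ω : BondConfig (Site d) | s(x, y) ∉ ω ∧ ¬ (openGraph ω).Reachable x y ∧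
        (n : ℕ∞) ≤ {e ∈ (zdGraph d).edgeSet | ∃ v ∈ e, v ∈ openCluster ω x}.encard ∧
        (n : ℕ∞) ≤ {e ∈ (zdGraph d).edgeSet | ∃ v ∈ e, v ∈ openCluster ω y}.encard ∧
        ((openCluster ω x).Finite ∨ (openCluster ω y).Finite)} = twoArm n (y, i) := by
      ext ω
      simp only [twoArm, Set.mem_setOf_eq, edgeOf, headOf, ← hi, touch, openCluster, Sym2.eq_swap (a := x)]
      constructor
      · rintro ⟨h1, h2, h3, h4, h5⟩
        exact ⟨h1, fun h => h2 (SimpleGraph.Reachable.symm h), h4, h3, h5.symm⟩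
      · rintro ⟨h1, h2, h3, h4, h5⟩
        exact ⟨h1, fun h => h2 (SimpleGraph.Reachable.symm h), h4, h3, h5.symm⟩
    rw [hS]
    exact twoGhost_of_volumeTail hd hn p hp0 x (y, i) ⟨i, Or.inr (by rw [hyx])⟩ hA hθ0 hθ1 htail

/-- **Registered sub-goal `twoGhost_of_volumeTail_zd` of stub A (`stub_condTwoGhost`)** — the two-ghost
inequality with an a-priori volume tail on `ℤ^d` (closed form of `twoGhost_of_volumeTail_adj`): for `d ≥ 1`,
`0 < p`, `n ≥ 1` and an edge `{x, y}`, if `P_p(|C(x)| ≥ m) ≤ A m^{-θ}` for all `m ≥ 1` (`A ≥ 0`, `0 ≤ θ < 1`)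
then `P_p({x,y} closed, x ↮ y, |E(C(x))| ≥ n, |E(C(y))| ≥ n, one finite) ≤ 32 d² √((1-p)/p) √(A/(1-θ)) n^{-(1+θ)/2}`.
[cite: Hutchcroft2021, Thm. 3.1 (two-ghost with a-priori tail)] [cite: Hutchcroft2020Locality, Corollary 1.7] -/
theorem twoGhost_of_volumeTail_zd : ∀ (d : ℕ), 1 ≤ d → ∀ (p : unitInterval), 0 < (p : ℝ) → ∀ (n : ℕ), 1 ≤ n → ∀ (x y : Site d), (zdGraph d).Adj x y → ∀ (A θ : ℝ), 0 ≤ A → 0 ≤ θ → θ < 1 → (∀ m : ℕ, 1 ≤ m → (bondPercolation (zdGraph d) p).real (clusterSizeGe x m) ≤ A * (m : ℝ) ^ (-θ)) → (bondPercolation (zdGraph d) p).real {ω | s(x, y) ∉ ω ∧ ¬ (openGraph ω).Reachable x y ∧ (n : ℕ∞) ≤ {e ∈ (zdGraph d).edgeSet | ∃ v ∈ e, v ∈ openCluster ω x}.encard ∧ (n : ℕ∞) ≤ {e ∈ (zdGraph d).edgeSet | ∃ v ∈ e, v ∈ openCluster ω y}.encard ∧ ((openCluster ω x).Finite ∨ (openCluster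 ω y).Finite)} ≤ 32 * (d : ℝ) ^ 2 * Real.sqrt ((1 - p) / p) * Real.sqrt (A / (1 - θ)) * (n : ℝ) ^ (-((1 + θ) / 2)) :=
  fun _ hd p hp0 _ hn x y hxy _ _ hA hθ0 hθ1 htail =>
    twoGhost_of_volumeTail_adj hd p hp0 hn x y hxy hA hθ0 hθ1 htail

end Summit.CriticalPhenomena.PercolationContinuityZ3.Theorems

end
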